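import Summits.NavierStokesRegularity.NavierStokesRegularity.Theorems.PalasekTowerBreakdownEpisodeBaseSliceExplicit
import Summits.NavierStokesRegularity.FluidComputer.PalasekTowerGermHostFreeRun

/-!
# `EpisodeBase` (crux stmt-NavierStokesRegularity-19179) from an explicit germ design and ONE FREE classical
# Navier–Stokes run meeting the first-window letter with margins — BY NAME

Cell `ns-blowup`, seat `ns-blowup-ecbridge-3` (g6; D-0074 GROUP C «BRIDGE SUPPORT», lineage
`host_preparation`). Route `PalasekTowerBreakdown`, crux `EpisodeBase`, line `slot` v5 (holder
ns-palasek-19179-p2): registered stub `stub_explicit_slice_run : ExplicitSliceRun` = SOME explicit germ design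
`(U, ρ, σ₀, ε, c₄)` in `Germ.LineGermData` and SOME classical finite-energy run on `[1, Host.τfirst]` under the
host's faded residual `lineForce U σ₀ ε` from `v 1 = U`, below `(5/3) Y₁`, meeting the level-`1` letter; its
composition is ecbridge-4 g5's `palasekTowerBreakdown_episodeBase_of_exists_lineGerm_selfRun` (p472431).
LABEL: E–C typing (KERNEL: theorems only; `--supports` stmt-NavierStokesRegularity-19179). WHAT THIS IS NOT: not
Navier–Stokes evidence — no free run meeting the letter is exhibited here; the theorems say what ONE such run
gives. Nothing about `RungG 1` or blow-up is asserted.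

## What is proved

* `palasekTowerBreakdown_exists_lineGerm_selfRun_of_exists_freeRun` — **THE FREE-RUN LETTER IMPLIES THE
  REGISTERED LETTER**: `(∃ (U, ρ, σ₀, ε₀, c₄, η) (LineGermData U ρ σ₀ ε₀ c₄) (v, q), v` classical with finite
  energy on `[1, Host.τfirst]` of the UNFORCED system (`ν = 1`) from `v 1 = U`, `η > 0`, `‖v‖ ≤ (5/3)Y₁ − η`,
  and at `Host.τfirst` in `‖x‖ ≤ ρ`: speed `≥ Y₁ + η`, strain `≥ A₁ + η`, an `N₁`-core loop of circulation
  `≥ N₁^{β−2} + η)` ⟹ the `∃`-statement of `stub_explicit_slice_run` VERBATIM (FluidComputer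
  `Germ.LineGermData.exists_sliceRun_of_freeRun`: THE PERTURBED RUN + the germ's `O(ε)` fade). A skeleton may
  therefore register the free-run letter as its stub and keep `EpisodeBase_of` unchanged.
* `palasekTowerBreakdown_episodeBase_of_lineGerm_freeRun` (plain binders) and
  `palasekTowerBreakdown_episodeBase_of_exists_lineGerm_freeRun` (∃-packaged) — `EpisodeBase` from the free-run
  letter.

READING (refuter4 K91/K94/K97 (2)(ii)(iii); HOLDER-CENSUS-19179 §6; OPT-𝔄-1): the numerics / certificate seat
no longer has to integrate the host's nonlocal fading force with its `Classical.choose` parameters — FREE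
Navier–Stokes from the explicit datum `U` with margins on the faces is the whole obligation; the fade length is
chosen inside the kernel by continuous dependence (sup-norm stability `Literature/…/ClassicalSupStabilityForced`,
bootstrap `…Bootstrap`, maximal classical solution `FluidComputer/PalasekTowerPerturbedRun`, KNSS (4.10) +
Landau for the gradient `…PerturbedRunGradient`). References: S. Palasek, arXiv:2605.13827 §4
[cite: Palasek2026ElementaryModel, §4]; T. Tao, Anal. PDE 6 (2013), Thm. 5.4 [cite: Tao2011, Thm. 5.4 (ii)+(iv)].
-/

noncomputable section

namespace Summit.NavierStokesRegularity.NavierStokesRegularity.Theorems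

open Set Function MeasureTheory Metric
open scoped ENNReal
open Summit.NavierStokesRegularity.NavierStokesRegularity.Theses
open Summit.NavierStokesRegularity.FluidComputer.PalasekTowerClayBridge
open Summit.NavierStokesRegularity.FluidComputer.PalasekTowerClayBridge.Germ
open Literature.Analysis.FluidPDE

/-- **THE FREE-RUN LETTER IMPLIES THE REGISTERED EXPLICIT LETTER.** SOME explicit germ design
`(U, ρ, σ₀, ε₀, c₄)` with `Germ.LineGermData U ρ σ₀ ε₀ c₄`, SOME margin `η > 0` and SOME classical
finite-energy run `(v, q)` of the UNFORCED Navier–Stokes system (`ν = 1`) on `[1, Host.τfirst]` from `v 1 = U`,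
with `‖v‖ ≤ (5/3) Y₁ − η` throughout and, at `Host.τfirst` in `‖x‖ ≤ ρ`, the speed floor `Y₁ + η`, the strain
floor `A₁ + η` and an `N₁`-core loop of circulation `≥ N₁^{β−2} + η` ⟹ the `∃`-statement registered as
`stub_explicit_slice_run` (explicit design, forced run under `lineForce`, cap `(5/3) Y₁`, the level-`1`
letter). [cite: Palasek2026ElementaryModel, §4] [cite: Tao2011, Thm. 5.4 (ii)+(iv)] -/
theorem palasekTowerBreakdown_exists_lineGerm_selfRun_of_exists_freeRun
    (hex : ∃ (U : EuclideanSpace ℝ (Fin 3) → EuclideanSpace ℝ (Fin 3)) (ρ σ₀ ε₀ c₄ η : ℝ)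
      (_ : LineGermData U ρ σ₀ ε₀ c₄)
      (v : ℝ → EuclideanSpace ℝ (Fin 3) → EuclideanSpace ℝ (Fin 3)) (q : ℝ → EuclideanSpace ℝ (Fin 3) → ℝ),
      IsClassicalNSSolutionOn (Icc 1 Host.τfirst) 1 0 v q ∧ v 1 = U ∧
      (∃ C : ℝ≥0∞, C < ⊤ ∧ ∀ t ∈ Icc (1 : ℝ) Host.τfirst, ∫⁻ x, ‖v t x‖ₑ ^ 2 ≤ C) ∧ 0 < η ∧
      (∀ t ∈ Icc (1 : ℝ) Host.τfirst, ∀ x, ‖v t x‖ ≤ 5 / 3 * TowerRates.wide.Y 1 - η) ∧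
      (∃ x, ‖x‖ ≤ ρ ∧ TowerRates.wide.Y 1 + η ≤ ‖v Host.τfirst x‖) ∧
      (∃ x, ‖x‖ ≤ ρ ∧ TowerRates.wide.A 1 + η ≤ ‖fderiv ℝ (v Host.τfirst) x‖) ∧
      (∃ (x : EuclideanSpace ℝ (Fin 3)) (γ : ℝ → EuclideanSpace ℝ (Fin 3)),
        ‖x‖ ≤ ρ ∧ ContDiff ℝ 1 γ ∧ γ 0 = γ 1 ∧
        (∀ s ∈ Icc (0 : ℝ) 1, γ s ∈ closedBall x (1 / TowerRates.wide.N 1)) ∧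
        (∀ s ∈ Icc (0 : ℝ) 1, ‖deriv γ s‖ ≤ 8 * Real.pi / TowerRates.wide.N 1) ∧
        TowerRates.wide.N 1 ^ (TowerRates.wide.β - 2) + η ≤ circulation (v Host.τfirst) γ)) :
    ∃ (U : EuclideanSpace ℝ (Fin 3) → EuclideanSpace ℝ (Fin 3)) (ρ σ₀ ε c₄ : ℝ)
      (_ : LineGermData U ρ σ₀ ε c₄)
      (v : ℝ → EuclideanSpace ℝ (Fin 3) → EuclideanSpace ℝ (Fin 3)) (q : ℝ → EuclideanSpace ℝ (Fin 3) → ℝ),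
      IsClassicalNSSolutionOn (Icc 1 Host.τfirst) 1 (lineForce U σ₀ ε) v q ∧ v 1 = U ∧
      (∃ C : ℝ≥0∞, C < ⊤ ∧ ∀ t ∈ Icc (1 : ℝ) Host.τfirst, ∫⁻ x, ‖v t x‖ₑ ^ 2 ≤ C) ∧
      (∀ t ∈ Icc (1 : ℝ) Host.τfirst, ∀ x, ‖v t x‖ ≤ 5 / 3 * TowerRates.wide.Y 1) ∧
      (∃ x, ‖x‖ ≤ ρ ∧ TowerRates.wide.Y 1 ≤ ‖v Host.τfirst x‖) ∧
      (∃ x, ‖x‖ ≤ ρ ∧ TowerRates.wide.A 1 ≤ ‖fderiv ℝ (v Host.τfirst) x‖) ∧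
      (∃ (x : EuclideanSpace ℝ (Fin 3)) (γ : ℝ → EuclideanSpace ℝ (Fin 3)),
        ‖x‖ ≤ ρ ∧ ContDiff ℝ 1 γ ∧ γ 0 = γ 1 ∧
        (∀ s ∈ Icc (0 : ℝ) 1, γ s ∈ Metric.closedBall x (1 / TowerRates.wide.N 1)) ∧
        (∀ s ∈ Icc (0 : ℝ) 1, ‖deriv γ s‖ ≤ 8 * Real.pi / TowerRates.wide.N 1) ∧
        TowerRates.wide.N 1 ^ (TowerRates.wide.β - 2) ≤ circulation (v Host.τfirst) γ) := by
  obtain ⟨U, ρ, σ₀, ε₀, c₄, η, d, v, q, hv, hv1, hvE, hη, hcap, hspeed, hstrain, hcore⟩ := hex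
  exact d.exists_sliceRun_of_freeRun hv hv1 hvE hη hcap hspeed hstrain hcore

/-- **`EpisodeBase` FROM AN EXPLICIT GERM DESIGN AND ONE FREE RUN WITH MARGINS** (plain binders): the explicit
door of record (`palasekTowerBreakdown_episodeBase_of_exists_lineGerm_selfRun`, ecbridge-4 g5) fed by the
FluidComputer theorem `Germ.LineGermData.exists_sliceRun_of_freeRun` (THE PERTURBED RUN).
[cite: Palasek2026ElementaryModel, §4] [cite: Tao2011, Thm. 5.4 (ii)+(iv)] -/
theorem palasekTowerBreakdown_episodeBase_of_lineGerm_freeRun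
    {U : EuclideanSpace ℝ (Fin 3) → EuclideanSpace ℝ (Fin 3)} {ρ σ₀ ε₀ c₄ : ℝ} (d : LineGermData U ρ σ₀ ε₀ c₄)
    {v : ℝ → EuclideanSpace ℝ (Fin 3) → EuclideanSpace ℝ (Fin 3)} {q : ℝ → EuclideanSpace ℝ (Fin 3) → ℝ}
    (hv : IsClassicalNSSolutionOn (Icc 1 Host.τfirst) 1 0 v q) (hv1 : v 1 = U)
    (hvE : ∃ C : ℝ≥0∞, C < ⊤ ∧ ∀ t ∈ Icc (1 : ℝ) Host.τfirst, ∫⁻ x, ‖v t x‖ₑ ^ 2 ≤ C)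
    {η : ℝ} (hη : 0 < η)
    (hcap : ∀ t ∈ Icc (1 : ℝ) Host.τfirst, ∀ x, ‖v t x‖ ≤ 5 / 3 * TowerRates.wide.Y 1 - η)
    (hspeed : ∃ x, ‖x‖ ≤ ρ ∧ TowerRates.wide.Y 1 + η ≤ ‖v Host.τfirst x‖)
    (hstrain : ∃ x, ‖x‖ ≤ ρ ∧ TowerRates.wide.A 1 + η ≤ ‖fderiv ℝ (v Host.τfirst) x‖)
    (hcore : ∃ (x : EuclideanSpace ℝ (Fin 3)) (γ : ℝ → EuclideanSpace ℝ (Fin 3)),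
      ‖x‖ ≤ ρ ∧ ContDiff ℝ 1 γ ∧ γ 0 = γ 1 ∧
      (∀ s ∈ Icc (0 : ℝ) 1, γ s ∈ closedBall x (1 / TowerRates.wide.N 1)) ∧
      (∀ s ∈ Icc (0 : ℝ) 1, ‖deriv γ s‖ ≤ 8 * Real.pi / TowerRates.wide.N 1) ∧
      TowerRates.wide.N 1 ^ (TowerRates.wide.β - 2) + η ≤ circulation (v Host.τfirst) γ) :
    PalasekTowerBreakdown.EpisodeBase :=
  palasekTowerBreakdown_episodeBase_of_exists_lineGerm_selfRun
    (d.exists_sliceRun_of_freeRun hv hv1 hvE hη hcap hspeed hstrain hcore)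

/-- **`EpisodeBase` FROM THE FREE-RUN LETTER** (∃-packaged; the shape a skeleton would register as a stub
`stub_explicit_free_run`): SOME explicit germ design, SOME margin `η > 0`, SOME classical finite-energy FREE
Navier–Stokes run (`ν = 1`, force `0`) on `[1, Host.τfirst]` from the profile, below `(5/3) Y₁ − η`, meeting the
level-`1` letter with margin `η` at `Host.τfirst` in `‖x‖ ≤ ρ` ⟹ `EpisodeBase`.
[cite: Palasek2026ElementaryModel, §4] [cite: Tao2011, Thm. 5.4 (ii)+(iv)] -/
theorem palasekTowerBreakdown_episodeBase_of_exists_lineGerm_freeRun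
    (hex : ∃ (U : EuclideanSpace ℝ (Fin 3) → EuclideanSpace ℝ (Fin 3)) (ρ σ₀ ε₀ c₄ η : ℝ)
      (_ : LineGermData U ρ σ₀ ε₀ c₄)
      (v : ℝ → EuclideanSpace ℝ (Fin 3) → EuclideanSpace ℝ (Fin 3)) (q : ℝ → EuclideanSpace ℝ (Fin 3) → ℝ),
      IsClassicalNSSolutionOn (Icc 1 Host.τfirst) 1 0 v q ∧ v 1 = U ∧
      (∃ C : ℝ≥0∞, C < ⊤ ∧ ∀ t ∈ Icc (1 : ℝ) Host.τfirst, ∫⁻ x, ‖v t x‖ₑ ^ 2 ≤ C) ∧ 0 < η ∧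
      (∀ t ∈ Icc (1 : ℝ) Host.τfirst, ∀ x, ‖v t x‖ ≤ 5 / 3 * TowerRates.wide.Y 1 - η) ∧
      (∃ x, ‖x‖ ≤ ρ ∧ TowerRates.wide.Y 1 + η ≤ ‖v Host.τfirst x‖) ∧
      (∃ x, ‖x‖ ≤ ρ ∧ TowerRates.wide.A 1 + η ≤ ‖fderiv ℝ (v Host.τfirst) x‖) ∧
      (∃ (x : EuclideanSpace ℝ (Fin 3)) (γ : ℝ → EuclideanSpace ℝ (Fin 3)),
        ‖x‖ ≤ ρ ∧ ContDiff ℝ 1 γ ∧ γ 0 = γ 1 ∧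
        (∀ s ∈ Icc (0 : ℝ) 1, γ s ∈ closedBall x (1 / TowerRates.wide.N 1)) ∧
        (∀ s ∈ Icc (0 : ℝ) 1, ‖deriv γ s‖ ≤ 8 * Real.pi / TowerRates.wide.N 1) ∧
        TowerRates.wide.N 1 ^ (TowerRates.wide.β - 2) + η ≤ circulation (v Host.τfirst) γ)) :
    PalasekTowerBreakdown.EpisodeBase :=
  palasekTowerBreakdown_episodeBase_of_exists_lineGerm_selfRun
    (palasekTowerBreakdown_exists_lineGerm_selfRun_of_exists_freeRun hex)

end Summit.NavierStokesRegularity.NavierStokesRegularity.Theorems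

end
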